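import Mathlib
import HarnessLib
import Literature.Analysis.FluidPDE.AxisymmetricEuler
import Summits.NavierStokesRegularity.NavierStokesRegularity.Theorems.PoloidalWindowRigidity.Negative.ResidueFalseWithClassRates

/-!
# Crux `PoloidalWindowRigidity` (K2, stmt-NavierStokesRegularity-19708) — negative side:
# the cellular witnesses have swirl about EVERY axis

Negative-side support (refuter seat ns-regularity-refuter1, cell ns-regularity-ideate; D-0081 §C).

* `cellField_swirl_every_axis`: for every rigid frame `(L, c)` (a linear isometry `L` of `ℝ³` and a centre `c`)
  the conjugated cellular field `z ↦ L⁻¹ V(L z + c)` has NON-ZERO swirl `Γ = z₀u₁ − z₁u₀` somewhere: the cellular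
  field is swirl-free about no axis whatsoever. Proof: no-swirl about the axis `c + ℝ·L e₂` says
  `⟪x − c, L e₀⟫⟪V x, L e₁⟫ = ⟪x − c, L e₁⟫⟪V x, L e₀⟫` for all `x`; evaluated at the four points
  `(π/2,π/2,π/2)`, `(π/2,0,π/2)`, `(0,π/2,π/2)` (where `V ∈ {2e₂, e₂}`) and `(0,π/2,0)`, `(0,π/2+2π,0)` (where
  `V = e₀`) it forces the `2 × 2` minors `f₀₁f₁₂ − f₁₁f₀₂`, `f₀₀f₁₂ − f₁₀f₀₂`, `f₀₀f₁₁ − f₀₁f₁₀` of the orthonormal pair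
  `fⱼ = L eⱼ` to vanish, contradicting `‖f₀ × f₁‖ = 1`.
* `cellProfile_swirl_every_axis`, `driftProfile_swirl_every_axis`: the same for every slice `s < 0` of the
  separated and of the drifting cellular profile (rescaling `y ↦ c(s)y`, recentring).
* `driftProfile_no_axisymmetric_noSwirl_slice`: hence no slice of the drifting profile is axisymmetric WITHOUT swirl
  in any frame — alternative (3) of the slice classification of the helicity door (route `LocalTubeDoorHelicity`,
  crux K2⁗ `FrobeniusProfileRigidity`, stub `SliceQuadrichotomy`) fails for the K2 negative-lane witness, like
  alternatives (1), (2) (`driftProfile_no_aligned_no_translationInvariant_slice`). [folklore]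
-/

noncomputable section

namespace Summit.NavierStokesRegularity.NavierStokesRegularity.Theorems.PoloidalWindowRigidity.Negative

open Set Function
open scoped RealInnerProductSpace InnerProductSpace
open Literature.Analysis Literature.Analysis.FluidPDE

/-- Coordinates of `L⁻¹ w` are the inner products of `w` with the frame vectors `L eⱼ`. [folklore] -/
theorem linearIsometryEquiv_symm_apply_coord
    (L : EuclideanSpace ℝ (Fin 3) ≃ₗᵢ[ℝ] EuclideanSpace ℝ (Fin 3)) (w : EuclideanSpace ℝ (Fin 3)) (j : Fin 3) :
    L.symm w j = ⟪w, L (EuclideanSpace.single j (1 : ℝ))⟫_ℝ := by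
  have h1 : L.symm w j = ⟪L.symm w, EuclideanSpace.single j (1 : ℝ)⟫_ℝ := by
    rw [EuclideanSpace.inner_single_right]; simp
  rw [h1, ← L.inner_map_map, L.apply_symm_apply]

/-- The no-swirl condition for the conjugated field `z ↦ L⁻¹ V(L z + c)`, read at the point `x = L z + c` of the
original field: `⟪x − c, L e₀⟫⟪V x, L e₁⟫ − ⟪x − c, L e₁⟫⟪V x, L e₀⟫ = 0`. [folklore] -/
theorem noSwirl_conj_identity {V : EuclideanSpace ℝ (Fin 3) → EuclideanSpace ℝ (Fin 3)}
    {L : EuclideanSpace ℝ (Fin 3) ≃ₗᵢ[ℝ] EuclideanSpace ℝ (Fin 3)} {c : EuclideanSpace ℝ (Fin 3)}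
    (hns : HasNoSwirl (fun z => L.symm (V (L z + c)))) (x : EuclideanSpace ℝ (Fin 3)) :
    ⟪x - c, L (EuclideanSpace.single 0 (1 : ℝ))⟫_ℝ * ⟪V x, L (EuclideanSpace.single 1 (1 : ℝ))⟫_ℝ -
      ⟪x - c, L (EuclideanSpace.single 1 (1 : ℝ))⟫_ℝ * ⟪V x, L (EuclideanSpace.single 0 (1 : ℝ))⟫_ℝ = 0 := by
  have h := hns (L.symm (x - c))
  simp only [swirl, LinearIsometryEquiv.apply_symm_apply, sub_add_cancel,
    linearIsometryEquiv_symm_apply_coord] at h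
  exact h

/-- Rescaling: if `y ↦ L⁻¹ (κ V(L (μ y) + c))` is swirl-free with `κ, μ ≠ 0`, so is `z ↦ L⁻¹ V(L z + c)`. [folklore] -/
theorem hasNoSwirl_of_rescaled {V : EuclideanSpace ℝ (Fin 3) → EuclideanSpace ℝ (Fin 3)}
    (L : EuclideanSpace ℝ (Fin 3) ≃ₗᵢ[ℝ] EuclideanSpace ℝ (Fin 3)) (c : EuclideanSpace ℝ (Fin 3)) {κ μ : ℝ}
    (hκ : κ ≠ 0) (hμ : μ ≠ 0) (h : HasNoSwirl (fun y => L.symm (κ • V (L (μ • y) + c)))) :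
    HasNoSwirl (fun z => L.symm (V (L z + c))) := by
  intro z
  have hz := h (μ⁻¹ • z)
  simp only [swirl, map_smul, smul_smul, mul_inv_cancel₀ hμ, one_smul, PiLp.smul_apply, smul_eq_mul] at hz
  simp only [swirl]
  have hmk : μ⁻¹ * κ ≠ 0 := mul_ne_zero (inv_ne_zero hμ) hκ
  have key : μ⁻¹ * κ * (z 0 * L.symm (V (L z + c)) 1 - z 1 * L.symm (V (L z + c)) 0) = 0 := by
    linear_combination hz
  rcases mul_eq_zero.1 key with h0 | h0
  · exact absurd h0 hmk
  · exact h0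

/-- **The cellular field has swirl about every axis**: for every rigid frame `(L, c)` the conjugated field
`z ↦ L⁻¹ V(L z + c)` is not swirl-free. [folklore] -/
theorem cellField_swirl_every_axis (L : EuclideanSpace ℝ (Fin 3) ≃ₗᵢ[ℝ] EuclideanSpace ℝ (Fin 3))
    (c : EuclideanSpace ℝ (Fin 3)) : ¬ HasNoSwirl (fun z => L.symm (cellField (L z + c))) := by
  intro hns
  set f₀ : EuclideanSpace ℝ (Fin 3) := L (EuclideanSpace.single 0 (1 : ℝ)) with hf₀
  set f₁ : EuclideanSpace ℝ (Fin 3) := L (EuclideanSpace.single 1 (1 : ℝ)) with hf₁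
  -- orthonormality of the frame pair, in coordinates
  have hn0 : f₀ 0 ^ 2 + f₀ 1 ^ 2 + f₀ 2 ^ 2 = 1 := by
    have h : ⟪f₀, f₀⟫_ℝ = 1 := by rw [hf₀, L.inner_map_map]; simp
    simp only [PiLp.inner_apply, RCLike.inner_apply, conj_trivial, Fin.sum_univ_three] at h
    linear_combination h
  have hn1 : f₁ 0 ^ 2 + f₁ 1 ^ 2 + f₁ 2 ^ 2 = 1 := by
    have h : ⟪f₁, f₁⟫_ℝ = 1 := by rw [hf₁, L.inner_map_map]; simp
    simp only [PiLp.inner_apply, RCLike.inner_apply, conj_trivial, Fin.sum_univ_three] at h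
    linear_combination h
  have h01 : f₀ 0 * f₁ 0 + f₀ 1 * f₁ 1 + f₀ 2 * f₁ 2 = 0 := by
    have h : ⟪f₀, f₁⟫_ℝ = 0 := by
      rw [hf₀, hf₁, L.inner_map_map]; simp [EuclideanSpace.inner_single_left]
    simp only [PiLp.inner_apply, RCLike.inner_apply, conj_trivial, Fin.sum_univ_three] at h
    linear_combination h
  -- the test points
  let e : Fin 3 → EuclideanSpace ℝ (Fin 3) := fun i => EuclideanSpace.single i (1 : ℝ)
  let P₁ : EuclideanSpace ℝ (Fin 3) := (Real.pi / 2) • e 0 + (Real.pi / 2) • e 1 + (Real.pi / 2) • e 2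
  let P₅ : EuclideanSpace ℝ (Fin 3) := (Real.pi / 2) • e 1
  have hV1 : cellField P₁ = (2 : ℝ) • e 2 := by
    ext i
    fin_cases i <;> simp [P₁, e, cellField_apply_zero, cellField_apply_one, cellField_apply_two]
    norm_num
  have hV2 : cellField (P₁ - (Real.pi / 2) • e 1) = e 2 := by
    ext i
    fin_cases i <;>
      simp [P₁, e, cellField_apply_zero, cellField_apply_one, cellField_apply_two]
  have hV3 : cellField (P₁ - (Real.pi / 2) • e 0) = e 2 := by
    ext i
    fin_cases i <;>
      simp [P₁, e, cellField_apply_zero, cellField_apply_one, cellField_apply_two]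
  have hV5 : cellField P₅ = e 0 := by
    ext i
    fin_cases i <;>
      simp [P₅, e, cellField_apply_zero, cellField_apply_one, cellField_apply_two]
  have hV6 : cellField (P₅ + (2 * Real.pi) • e 1) = e 0 := by
    ext i
    fin_cases i <;>
      simp [P₅, e, cellField_apply_zero, cellField_apply_one, cellField_apply_two]
  -- inner products of the frame vectors with the basis vectors are their coordinates
  have hin : ∀ (i : Fin 3) (f : EuclideanSpace ℝ (Fin 3)), ⟪e i, f⟫_ℝ = f i := by
    intro i f
    simp [e, EuclideanSpace.inner_single_left]
  -- the five swirl identities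
  have E1 := noSwirl_conj_identity hns P₁
  have E2 := noSwirl_conj_identity hns (P₁ - (Real.pi / 2) • e 1)
  have E3 := noSwirl_conj_identity hns (P₁ - (Real.pi / 2) • e 0)
  have E5 := noSwirl_conj_identity hns P₅
  have E6 := noSwirl_conj_identity hns (P₅ + (2 * Real.pi) • e 1)
  rw [hV1] at E1
  rw [hV2] at E2
  rw [hV3] at E3
  rw [hV5] at E5
  rw [hV6] at E6
  rw [← hf₀, ← hf₁] at E1 E2 E3 E5 E6
  simp only [inner_smul_left, inner_sub_left, inner_add_left, hin, conj_trivial] at E1 E2 E3 E5 E6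
  -- from here on: pure algebra in the coordinates of `f₀, f₁` and the two numbers `⟪P₁ - c, fⱼ⟫`, `⟪P₅ - c, fⱼ⟫`
  have hpi : Real.pi ≠ 0 := Real.pi_ne_zero
  have R1 : f₀ 1 * f₁ 2 = f₁ 1 * f₀ 2 := by
    have h : Real.pi / 2 * (f₀ 1 * f₁ 2 - f₁ 1 * f₀ 2) = 0 := by linear_combination E1 / 2 - E2
    have h' := mul_eq_zero.1 h
    rcases h' with h' | h'
    · exact absurd h' (by positivity)
    · linear_combination h'
  have R2 : f₀ 0 * f₁ 2 = f₁ 0 * f₀ 2 := by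
    have h : Real.pi / 2 * (f₀ 0 * f₁ 2 - f₁ 0 * f₀ 2) = 0 := by linear_combination E1 / 2 - E3
    rcases mul_eq_zero.1 h with h' | h'
    · exact absurd h' (by positivity)
    · linear_combination h'
  have R3 : f₀ 1 * f₁ 0 = f₁ 1 * f₀ 0 := by
    have h : 2 * Real.pi * (f₀ 1 * f₁ 0 - f₁ 1 * f₀ 0) = 0 := by linear_combination E6 - E5
    rcases mul_eq_zero.1 h with h' | h'
    · exact absurd h' (by positivity)
    · linear_combination h'
  have ha2 : f₀ 2 = 0 := by
    linear_combination (-(f₀ 2)) * hn1 + f₁ 2 * h01 - f₁ 0 * R2 - f₁ 1 * R1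
  have hb2 : f₁ 2 = 0 := by
    linear_combination (-(f₁ 2)) * hn0 + f₀ 2 * h01 + f₀ 0 * R2 + f₀ 1 * R1
  have H1 : f₀ 0 ^ 2 + f₀ 1 ^ 2 = 1 := by rw [ha2] at hn0; linear_combination hn0
  have H2 : f₁ 0 ^ 2 + f₁ 1 ^ 2 = 1 := by rw [hb2] at hn1; linear_combination hn1
  have H3 : f₀ 0 * f₁ 0 + f₀ 1 * f₁ 1 = 0 := by rw [ha2] at h01; linear_combination h01
  have H : (1 : ℝ) = 0 := by
    linear_combination (-(f₁ 0 ^ 2 + f₁ 1 ^ 2)) * H1 + (-1 : ℝ) * H2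
      + (f₀ 0 * f₁ 0 + f₀ 1 * f₁ 1) * H3 + (f₀ 1 * f₁ 0 - f₀ 0 * f₁ 1) * R3
  exact one_ne_zero H

/-- The separated cellular profile has swirl about every axis, on every slice `s < 0`. [folklore] -/
theorem cellProfile_swirl_every_axis {s : ℝ} (hs : s < 0)
    (L : EuclideanSpace ℝ (Fin 3) ≃ₗᵢ[ℝ] EuclideanSpace ℝ (Fin 3)) (c : EuclideanSpace ℝ (Fin 3)) :
    ¬ HasNoSwirl (fun y => L.symm (cellProfile s (L y + c))) := by
  intro hns
  refine cellField_swirl_every_axis L c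
    (hasNoSwirl_of_rescaled L c (cellAmp_pos hs).ne' (one_ne_zero (α := ℝ)) ?_)
  simpa [cellProfile] using hns

/-- The drifting cellular profile has swirl about every axis, on every slice `s < 0`. [folklore] -/
theorem driftProfile_swirl_every_axis {s : ℝ} (hs : s < 0)
    (L : EuclideanSpace ℝ (Fin 3) ≃ₗᵢ[ℝ] EuclideanSpace ℝ (Fin 3)) (c : EuclideanSpace ℝ (Fin 3)) :
    ¬ HasNoSwirl (fun y => L.symm (driftProfile s (L y + c))) := by
  intro hns
  refine cellField_swirl_every_axis L
    (cellAmp s • c + Real.log (-s) • EuclideanSpace.single (1 : Fin 3) (1 : ℝ))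
    (hasNoSwirl_of_rescaled L _ (cellAmp_pos hs).ne' (cellAmp_pos hs).ne' ?_)
  have hu : (fun y => L.symm (driftProfile s (L y + c))) = fun y =>
      L.symm (cellAmp s • cellField (L (cellAmp s • y) +
        (cellAmp s • c + Real.log (-s) • EuclideanSpace.single (1 : Fin 3) (1 : ℝ)))) := by
    funext y
    simp only [driftProfile, driftShift, map_smul, smul_add, add_assoc]
  rw [hu] at hns
  exact hns

/-- **Alternative (3) of the helicity door's slice classification fails for the K2 witness**: no slice `s < 0` of the
drifting cellular profile is axisymmetric without swirl in any rigid frame `(L, c)` — indeed it is not even swirl-free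
about any axis. [folklore] -/
theorem driftProfile_no_axisymmetric_noSwirl_slice :
    ¬ ∃ s < 0, ∃ (L : EuclideanSpace ℝ (Fin 3) ≃ₗᵢ[ℝ] EuclideanSpace ℝ (Fin 3)) (c : EuclideanSpace ℝ (Fin 3)),
      IsAxisymmetric (fun y => L.symm (driftProfile s (L y + c))) ∧
        HasNoSwirl (fun y => L.symm (driftProfile s (L y + c))) := by
  rintro ⟨s, hs, L, c, -, hns⟩
  exact driftProfile_swirl_every_axis hs L c hns

end Summit.NavierStokesRegularity.NavierStokesRegularity.Theorems.PoloidalWindowRigidity.Negative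

end
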